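import Literature.Analysis.FunctionSpaces.HolderManifoldModelOperator
import Mathlib.LinearAlgebra.Matrix.PosDef
import HarnessLib

/-!
# The chart coefficients of `Δ_g`: symmetry, uniform ellipticity, cutoff plateaus, and the `C⁰`
# bound for `L₀ = Δ_g − 1` (Hölder spaces, part 26)

Topic `Literature/Analysis/FunctionSpaces`. The coefficient hypotheses of the global Schauder
estimate (`HolderManifoldSchauder.lean`; Gilbarg–Trudinger 2001, Thm. 6.2) for the chart
representation of the Laplace–Beltrami operator (part 15, `dalembertianPieceCLM_apply_eq`:
principal coefficients `Ĝ⁻¹ = gramInv`), and the a priori `C⁰` bound for the model operator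
`L₀ = Δ_g − 1` of part 16 on a closed Riemannian manifold:

* `exists_pos_forall_le_of_finite` — finitely many positive reals have a common positive lower
  bound;
* `quadratic_le_card_mul_of_abs_le` — `∑ aᵢⱼ ξᵢ ξⱼ ≤ |κ| K ∑ ξᵢ²` when `|aᵢⱼ| ≤ K`;
* `exists_ellipticity_const_of_continuousOn` — a family of positive definite quadratic forms,
  continuous on a compact set, is uniformly elliptic there;
* `gramInv_symm`, `gramInv_quadratic_pos` — `Ĝ⁻¹` is symmetric, and positive definite on the
  chart target for Riemannian `g` (`Ĝ` is the Gram matrix of a coordinate frame, hence positive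
  definite, and so is its inverse: Mathlib's `Matrix.PosDef.inv`);
* `HolderChartData.mem_target_of_cutoff_ne_zero`,
  `HolderChartData.exists_cthickening_cutoff_eq_one` — one radius `ρ₁ > 0` such that every chart
  cutoff `η_j` equals `1` on the closed `ρ₁`-thickening of `chart_j(tsupport ρ_j)` (so these
  thickenings lie in the chart targets);
* `HolderManifoldFunction.norm_apply_le_card_mul_norm_modelOperator` —
  `|u x| ≤ card ι · ‖(Δ_g − 1) u‖_{C^{k,r}_𝔄}`: at a maximum of `u`, `Δ_g u ≤ 0`; at a minimum,
  `Δ_g u ≥ 0` (the closed-manifold form of Gilbarg–Trudinger 2001, Thm. 3.7 with `c = −1`).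

Bricks of census item (2a) of
`Literature.Geometry.Riemannian.gurskyViaclovsky_pathOpen_weighted_four` (the Schauder estimate
for `Δ_g − 1`). Everything is proved; no named facts.

## References

* D. Gilbarg, N. S. Trudinger, *Elliptic Partial Differential Equations of Second Order* (2001),
  §3.1, Thm. 3.7, §6.1, Thm. 6.2. [GilbargTrudinger2001]
-/

noncomputable section

open Set Filter Function
open scoped NNReal Topology Manifold ContDiff

namespace Literature.Analysis.FunctionSpaces

open Literature.Geometry.Lorentzian PseudoRiemannianMetric

/-! ### Generic tools -/

/-- Finitely many positive reals have a common positive lower bound. [folklore] -/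
theorem exists_pos_forall_le_of_finite {ι : Type*} [Finite ι] {δ : ι → ℝ} (h : ∀ i, 0 < δ i) :
    ∃ ρ : ℝ, 0 < ρ ∧ ∀ i, ρ ≤ δ i := by
  rcases isEmpty_or_nonempty ι with hι | hι
  · exact ⟨1, one_pos, fun i => isEmptyElim i⟩
  · obtain ⟨i₀, hi₀⟩ := Finite.exists_min δ
    exact ⟨δ i₀, h i₀, hi₀⟩

/-- An elementary upper bound for a quadratic form with bounded coefficients:
`∑ᵢⱼ aᵢⱼ ξᵢ ξⱼ ≤ |κ| K ∑ᵢ ξᵢ²` if `|aᵢⱼ| ≤ K` (`2|ξᵢ||ξⱼ| ≤ ξᵢ² + ξⱼ²`). [folklore] -/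
theorem quadratic_le_card_mul_of_abs_le {κ : Type*} [Fintype κ] {a : κ → κ → ℝ} {K : ℝ}
    (h : ∀ i i', |a i i'| ≤ K) (ξ : κ → ℝ) :
    ∑ i, ∑ i', a i i' * ξ i * ξ i' ≤ Fintype.card κ * K * ∑ i, ξ i ^ 2 := by
  calc ∑ i, ∑ i', a i i' * ξ i * ξ i' ≤ ∑ i, ∑ i', (K / 2 * ξ i ^ 2 + K / 2 * ξ i' ^ 2) := by
        refine Finset.sum_le_sum fun i _ => Finset.sum_le_sum fun i' _ => ?_
        have hK : 0 ≤ K := (abs_nonneg _).trans (h i i')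
        have h1 : a i i' * ξ i * ξ i' ≤ |a i i'| * (|ξ i| * |ξ i'|) := by
          rw [← abs_mul, ← abs_mul, mul_assoc]
          exact le_abs_self _
        have h2 : |ξ i| * |ξ i'| ≤ (ξ i ^ 2 + ξ i' ^ 2) / 2 := by
          nlinarith [sq_nonneg (|ξ i| - |ξ i'|), sq_abs (ξ i), sq_abs (ξ i')]
        nlinarith [h i i', abs_nonneg (a i i'), mul_nonneg (abs_nonneg (ξ i)) (abs_nonneg (ξ i'))]
    _ = Fintype.card κ * K * ∑ i, ξ i ^ 2 := by
        have e1 : ∀ i, ∑ i', (K / 2 * ξ i ^ 2 + K / 2 * ξ i' ^ 2) =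
            Fintype.card κ * (K / 2 * ξ i ^ 2) + K / 2 * ∑ i', ξ i' ^ 2 := fun i => by
          rw [Finset.sum_add_distrib, Finset.sum_const, Finset.card_univ, nsmul_eq_mul,
            Finset.mul_sum]
        rw [Finset.sum_congr rfl fun i _ => e1 i, Finset.sum_add_distrib, Finset.sum_const,
          Finset.card_univ, nsmul_eq_mul, ← Finset.mul_sum, ← Finset.mul_sum]
        ring

-- adapted from `Literature.Geometry.Riemannian.exists_ellipticity_const`
-- (`Literature/Geometry/Riemannian/RicciDeTurckChartNormSq.lean`), with the index order of
-- `exists_schauder_global`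
/-- **Uniform ellipticity of a continuous family of positive definite quadratic forms on a
compact set**: if `ξ ↦ ∑ G(x)ᵢⱼ ξᵢ ξⱼ` is positive definite for every `x ∈ K`, `K` compact, and
the coefficients are continuous on `K`, then `λ ∑ ξᵢ² ≤ ∑ G(x)ᵢⱼ ξᵢ ξⱼ` on `K` for some `λ > 0`
(minimise over `K × {‖ξ‖ = 1}`, homogeneity, `∑ ξᵢ² ≤ |κ| ‖ξ‖²_∞`). [folklore] -/
theorem exists_ellipticity_const_of_continuousOn {X : Type*} [TopologicalSpace X] {κ : Type*}
    [Fintype κ] {K : Set X} (hK : IsCompact K) {G : X → κ → κ → ℝ}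
    (hG : ∀ i i', ContinuousOn (fun x => G x i i') K)
    (hpos : ∀ x ∈ K, ∀ ξ : κ → ℝ, ξ ≠ 0 → 0 < ∑ i, ∑ i', G x i i' * ξ i * ξ i') :
    ∃ lam : ℝ, 0 < lam ∧ ∀ x ∈ K, ∀ ξ : κ → ℝ,
      lam * ∑ i, ξ i ^ 2 ≤ ∑ i, ∑ i', G x i i' * ξ i * ξ i' := by
  set f : X × (κ → ℝ) → ℝ := fun z => ∑ i, ∑ i', G z.1 i i' * z.2 i * z.2 i' with hf
  set Ks : Set (X × (κ → ℝ)) := K ×ˢ Metric.sphere 0 1 with hKs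
  have hKsc : IsCompact Ks := hK.prod (isCompact_sphere 0 1)
  have hfc : ContinuousOn f Ks := by
    have h1 : ∀ i i', ContinuousOn (fun z : X × (κ → ℝ) => G z.1 i i') Ks :=
      fun i i' => (hG i i').comp continuous_fst.continuousOn fun z hz => hz.1
    have h2 : ∀ i, ContinuousOn (fun z : X × (κ → ℝ) => z.2 i) Ks :=
      fun i => ((continuous_apply i).comp continuous_snd).continuousOn
    simp only [hf]
    refine continuousOn_finsetSum _ fun i _ => continuousOn_finsetSum _ fun i' _ => ?_
    exact ((h1 i i').mul (h2 i)).mul (h2 i')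
  have hfpos : ∀ z ∈ Ks, 0 < f z := by
    rintro ⟨x, ξ⟩ ⟨hx, hξ⟩
    have hξ0 : ξ ≠ 0 := by
      intro h0
      rw [h0, mem_sphere_zero_iff_norm, norm_zero] at hξ
      exact zero_ne_one hξ
    exact hpos x hx ξ hξ0
  -- homogeneity, normalisation and comparison of `∑ ξ²` with the sup norm
  have hhom : ∀ (x : X) (r : ℝ) (ξ : κ → ℝ), f (x, r • ξ) = r ^ 2 * f (x, ξ) := by
    intro x r ξ
    simp only [hf, Pi.smul_apply, smul_eq_mul, Finset.mul_sum]
    refine Finset.sum_congr rfl fun i _ => Finset.sum_congr rfl fun i' _ => ?_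
    ring
  have hmemKs : ∀ x ∈ K, ∀ ξ : κ → ℝ, ξ ≠ 0 → (x, ‖ξ‖⁻¹ • ξ) ∈ Ks := fun x hx ξ hξ => by
    refine ⟨hx, ?_⟩
    rw [mem_sphere_zero_iff_norm, norm_smul, norm_inv, norm_norm,
      inv_mul_cancel₀ (norm_pos_iff.2 hξ).ne']
  have hsq : ∀ ξ : κ → ℝ, ∑ i, ξ i ^ 2 ≤ Fintype.card κ * ‖ξ‖ ^ 2 := by
    intro ξ
    have h1 : ∀ i, ξ i ^ 2 ≤ ‖ξ‖ ^ 2 := fun i => by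
      rw [← sq_abs, ← Real.norm_eq_abs]
      exact pow_le_pow_left₀ (norm_nonneg _) (norm_le_pi_norm ξ i) 2
    calc ∑ i, ξ i ^ 2 ≤ ∑ _i : κ, ‖ξ‖ ^ 2 := Finset.sum_le_sum fun i _ => h1 i
      _ = Fintype.card κ * ‖ξ‖ ^ 2 := by
          rw [Finset.sum_const, Finset.card_univ, nsmul_eq_mul]
  have hzero : ∀ x : X, f (x, 0) = 0 := by
    intro x
    simp only [hf, Pi.zero_apply, mul_zero, Finset.sum_const_zero]
  -- the minimum over `Ks`
  have key : ∃ lam₀ : ℝ, 0 < lam₀ ∧ ∀ x ∈ K, ∀ ξ : κ → ℝ, lam₀ * ‖ξ‖ ^ 2 ≤ f (x, ξ) := by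
    by_cases hne : Ks.Nonempty
    · obtain ⟨z₀, hz₀, hmin⟩ := hKsc.exists_isMinOn hne hfc
      refine ⟨f z₀, hfpos z₀ hz₀, fun x hx ξ => ?_⟩
      by_cases hξ : ξ = 0
      · subst hξ
        rw [norm_zero, zero_pow two_ne_zero, mul_zero, hzero]
      · have hξn : 0 < ‖ξ‖ := norm_pos_iff.2 hξ
        have h1 : f z₀ ≤ f (x, ‖ξ‖⁻¹ • ξ) := hmin (hmemKs x hx ξ hξ)
        rw [hhom] at h1
        calc f z₀ * ‖ξ‖ ^ 2 ≤ ‖ξ‖⁻¹ ^ 2 * f (x, ξ) * ‖ξ‖ ^ 2 :=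
              mul_le_mul_of_nonneg_right h1 (by positivity)
          _ = f (x, ξ) := by field_simp
    · refine ⟨1, one_pos, fun x hx ξ => ?_⟩
      by_cases hξ : ξ = 0
      · subst hξ
        rw [norm_zero, zero_pow two_ne_zero, mul_zero, hzero]
      · exact (hne ⟨_, hmemKs x hx ξ hξ⟩).elim
  obtain ⟨lam₀, hlam₀, hkey⟩ := key
  refine ⟨lam₀ / max 1 (Fintype.card κ : ℝ), by positivity, fun x hx ξ => ?_⟩
  have hm : (Fintype.card κ : ℝ) ≤ max 1 (Fintype.card κ : ℝ) := le_max_right _ _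
  calc lam₀ / max 1 (Fintype.card κ : ℝ) * ∑ i, ξ i ^ 2
      ≤ lam₀ / max 1 (Fintype.card κ : ℝ) * (max 1 (Fintype.card κ : ℝ) * ‖ξ‖ ^ 2) := by
        refine mul_le_mul_of_nonneg_left ((hsq ξ).trans ?_) (by positivity)
        exact mul_le_mul_of_nonneg_right hm (by positivity)
    _ = lam₀ * ‖ξ‖ ^ 2 := by field_simp
    _ ≤ f (x, ξ) := hkey x hx ξ

/-! ### The inverse metric coefficients `Ĝ⁻¹`: symmetry and positivity -/

section Coefficients

variable {E : Type*} [NormedAddCommGroup E] [NormedSpace ℝ E] {M : Type*} [TopologicalSpace M]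
  [ChartedSpace E M] [IsManifold 𝓘(ℝ, E) ∞ M]
  {κ : Type*} [Fintype κ] [DecidableEq κ] (bE : Module.Basis κ ℝ E)
  (g : PseudoRiemannianMetric 𝓘(ℝ, E) ∞ E (TangentSpace 𝓘(ℝ, E) : M → Type _)) (c : M)

/-- **The inverse metric coefficients `Ĝ⁻¹` are symmetric** (`Ĝ` is symmetric and
`(Aᵀ)⁻¹ = (A⁻¹)ᵀ`). [folklore] -/
theorem gramInv_symm (y : E) (a b : κ) : gramInv bE g c y a b = gramInv bE g c y b a := by
  have hT : (Matrix.of (gram bE g c y)).transpose = Matrix.of (gram bE g c y) := by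
    ext i j
    exact g.symm _ _ _
  have h2 : ((Matrix.of (gram bE g c y))⁻¹).transpose = (Matrix.of (gram bE g c y))⁻¹ := by
    rw [Matrix.transpose_nonsing_inv, hT]
  have h3 := congrFun (congrFun h2 b) a
  rw [Matrix.transpose_apply] at h3
  show (Matrix.of (gram bE g c y))⁻¹ a b = (Matrix.of (gram bE g c y))⁻¹ b a
  exact h3

/-- **`Ĝ⁻¹` is positive definite on the chart target** for Riemannian `g`: `Ĝ(y)` is the Gram
matrix of the coordinate frame at `chart_c⁻¹ y` (a basis) under the positive definite `g`, hence
positive definite, and so is its inverse. [folklore] -/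
theorem gramInv_quadratic_pos (hg : g.IsRiemannian) {y : E} (hy : y ∈ (chartAt E c).target)
    {ξ : κ → ℝ} (hξ : ξ ≠ 0) : 0 < ∑ i, ∑ i', gramInv bE g c y i i' * ξ i * ξ i' := by
  set G : Matrix κ κ ℝ := Matrix.of (gram bE g c y) with hG
  set p : M := (chartAt E c).symm y with hp
  have hps : p ∈ (chartAt E c).source := (chartAt E c).map_target hy
  have hext : (extChartAt 𝓘(ℝ, E) c).symm y = p := by
    rw [hp]
    simp
  have hpe : p ∈ (trivializationAt E (TangentSpace 𝓘(ℝ, E)) c).baseSet := by simpa using hps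
  set β := (trivializationAt E (TangentSpace 𝓘(ℝ, E)) c).basisAt bE hpe with hβ
  have hFr : ∀ i, (trivializationAt E (TangentSpace 𝓘(ℝ, E)) c).localFrame bE i p = β i := fun i =>
    Bundle.Trivialization.localFrame_apply_of_mem_baseSet _ bE hpe
  have hGpos : G.PosDef := by
    refine Matrix.PosDef.of_dotProduct_mulVec_pos ?_ fun v hv => ?_
    · ext i j
      simp only [Matrix.conjTranspose_apply, star_trivial, hG, Matrix.of_apply]
      exact g.symm _ _ _
    · have hq : star v ⬝ᵥ (G.mulVec v) = g.val p (∑ i, v i • β i) (∑ j, v j • β j) := by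
        simp only [hG, dotProduct, Matrix.mulVec, star_trivial, Matrix.of_apply, gram,
          map_sum, map_smul, FunLike.coe_sum, FunLike.coe_smul, Finset.sum_apply, Pi.smul_apply,
          smul_eq_mul, Finset.mul_sum]
        rw [hext]
        refine Finset.sum_congr rfl fun k _ => Finset.sum_congr rfl fun l _ => ?_
        rw [hFr, hFr, g.symm p (β l) (β k)]
        ring
      rw [hq]
      refine hg p _ fun h0 => hv ?_
      funext i
      exact Fintype.linearIndependent_iff.1 β.linearIndependent v h0 i
  have hsum : star ξ ⬝ᵥ (G⁻¹.mulVec ξ) = ∑ i, ∑ i', gramInv bE g c y i i' * ξ i * ξ i' := by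
    simp only [dotProduct, Matrix.mulVec, star_trivial, Finset.mul_sum, gramInv, ← hG]
    refine Finset.sum_congr rfl fun i _ => Finset.sum_congr rfl fun i' _ => ?_
    ring
  rw [← hsum]
  exact (hGpos.inv).dotProduct_mulVec_pos hξ

end Coefficients

/-! ### Plateaus of the chart cutoffs and the `C⁰` bound for `Δ_g − 1` -/

section Manifold

variable {ι : Type*} [Fintype ι] {E : Type} [NormedAddCommGroup E] [NormedSpace ℝ E]
  [FiniteDimensional ℝ E] {M : Type*} [TopologicalSpace M] [ChartedSpace E M] [CompactSpace M]

omit [Fintype ι] in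
/-- Where a chart cutoff does not vanish one is in the chart target. [folklore] -/
theorem HolderChartData.mem_target_of_cutoff_ne_zero (𝔄 : HolderChartData ι E M) {j : ι} {y : E}
    (h : 𝔄.cutoff j y ≠ 0) : y ∈ (𝔄.chart j).target :=
  𝔄.tsupport_cutoff_subset j (subset_tsupport _ (mem_support.2 h))

/-- **A common plateau radius for the chart cutoffs**: there is `ρ₁ > 0` such that every cutoff
`η_j` equals `1` on the closed `ρ₁`-thickening of `chart_j(tsupport ρ_j)` (each `η_j = 1` near
that compact set, `hasBasis_nhdsSet_cthickening`; finitely many `j`). [folklore] -/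
theorem HolderChartData.exists_cthickening_cutoff_eq_one (𝔄 : HolderChartData ι E M) :
    ∃ ρ₁ : ℝ, 0 < ρ₁ ∧ ∀ j, ∀ y ∈ Metric.cthickening ρ₁ (𝔄.chart j '' tsupport (𝔄.ρ j)),
      𝔄.cutoff j y = 1 := by
  have hδ' : ∀ j, ∃ δ : ℝ, 0 < δ ∧ ∀ ⦃y⦄,
      y ∈ Metric.cthickening δ (𝔄.chart j '' tsupport (𝔄.ρ j)) → 𝔄.cutoff j y = 1 := fun j =>
    (Metric.hasBasis_nhdsSet_cthickening (𝔄.isCompact_image_tsupport j).1).eventually_iff.1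
      (𝔄.cutoff_eq_one j)
  choose δ hδ0 hδ1 using hδ'
  obtain ⟨ρ₁, hρ₁, hle⟩ := exists_pos_forall_le_of_finite hδ0
  exact ⟨ρ₁, hρ₁, fun j y hy => hδ1 j (Metric.cthickening_mono (hle j) _ hy)⟩

variable [IsManifold 𝓘(ℝ, E) ∞ M] {k : ℕ} {r : ℝ≥0}

/-- **A priori `C⁰` bound for `L₀ = Δ_g − 1`** on a closed Riemannian manifold:
`|u x| ≤ sup |Δ_g u − u| ≤ card ι · ‖(Δ_g − 1) u‖_{C^{k,r}_𝔄}` — at a maximum `x₀` of `u`,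
`Δ_g u (x₀) ≤ 0`, so `u x₀ ≤ −(Δ_g u − u)(x₀)`; symmetrically at a minimum. The closed-manifold
form of Gilbarg–Trudinger 2001, Thm. 3.7 (`c = −1`, no boundary, no barrier), combined with
`‖f x‖ ≤ card ι · ‖f‖` (`norm_apply_le`). [cite: GilbargTrudinger2001, §3.1, Thm. 3.7] -/
theorem HolderManifoldFunction.norm_apply_le_card_mul_norm_modelOperator
    (𝔄 : HolderChartData ι E M)
    (g : PseudoRiemannianMetric 𝓘(ℝ, E) ∞ E (TangentSpace 𝓘(ℝ, E) : M → Type _)) [g.HasLeviCivita]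
    (hg : g.IsRiemannian) (hr : r ≤ 1) (u : HolderManifoldFunction 𝔄 ℝ (k + 2) r) (x : M) :
    ‖u x‖ ≤ Fintype.card ι * ‖modelOperatorCLM 𝔄 g hr u‖ := by
  have hf : ∀ y, |g.dalembertian u y - u y| ≤ Fintype.card ι * ‖modelOperatorCLM 𝔄 g hr u‖ :=
    fun y => by
      have h := (modelOperatorCLM 𝔄 g hr u).norm_apply_le y
      rw [modelOperatorCLM_apply, Real.norm_eq_abs] at h
      exact h
  obtain ⟨x₀, -, hmax⟩ :=
    isCompact_univ.exists_isMaxOn ⟨x, mem_univ x⟩ u.continuous.continuousOn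
  obtain ⟨x₁, -, hmin⟩ :=
    isCompact_univ.exists_isMinOn ⟨x, mem_univ x⟩ u.continuous.continuousOn
  have h1 : g.dalembertian u x₀ ≤ 0 :=
    g.dalembertian_nonpos_of_isLocalMax (u.contMDiffAt_two x₀) (hmax.isLocalMax univ_mem) (hg x₀)
  have h2 : 0 ≤ g.dalembertian u x₁ :=
    g.dalembertian_nonneg_of_isLocalMin (u.contMDiffAt_two x₁) (hmin.isLocalMin univ_mem) (hg x₁)
  have e0 := hf x₀
  have e1 := hf x₁
  rw [abs_le] at e0 e1
  have hle : u x ≤ u x₀ := hmax (mem_univ x)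
  have hge : u x₁ ≤ u x := hmin (mem_univ x)
  rw [Real.norm_eq_abs, abs_le]
  constructor <;> linarith [e0.1, e0.2, e1.1, e1.2]

end Manifold

end Literature.Analysis.FunctionSpaces

end
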